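import Summits.QuantumFields.YangMills.Theorems.UV3BranchExpansionCountingAmortizedInduction
import HarnessLib

/-!
# `UV3BranchExpansionCountingAmortized` — THE AMORTIZED COVERING INEQUALITY for the branch (Möbius) expansion of the guarded averaging
# (crux `UnitScaleTilt.HistoryTailL`, stmt-QuantumFields-19936 — SUPPLY side, record-independent finite combinatorics)

Cell `ym3-torus` (YM ladder rung R3 = continuum SU(2) Yang–Mills on T³ — a RUNG, NOT d = 4, NOT infinite volume, NOT a mass gap, NOT Clay);
width seat `ym-ust-19936-w2` (gen 17), explicit-unit helper; `--supports stmt-QuantumFields-19936 --as helper`.  THEOREMS ONLY (0 `def`,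
0 `sorry`, default heartbeats).

WHAT.  LEAD ★w1-19936 g12's note `Cruxes/HistoryTailL/HTopBranchExpansion.md` reduces the K-uniform top push-forward bound hTop for the guarded
averaging `avT3` to (E) the branch expansion (✓`UV3BranchExpansionDomination`), (A) the restricted one-level transport (✓`UV3BranchExpansion
RestrictedDensity` ∕ ✓`UV3GuardHybridRestrictedTransport`), (M) the mute-element cancellation, and (C) a COUNT of the live switch-site patterns:
`Σ_{𝐬 live} x^{|𝐬|} ≤ e^{c}` with `c` independent of the number of levels.  §5 (C) of the note counted live patterns by exploration trees; that
injection fails when one reader serves several ghost segments (FINDING, bus 2026-08-30: w2 g17 ∕ px13 g13 ∕ px17 g9).  THIS FILE states and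
proves the REPAIRED count, in the setting of `UV3BranchExpansionCountingAmortizedInduction` (patterns `p : (i : Fin n) → Finset (β (i+1))`,
hypothesis-specified `Dist`, `X`, `N`):

★★★ `sum_pow_card_le_of_discoverable`: if `0 ≤ x`, `0 < y ≤ 1`, the six geometric hypotheses hold at every level pair together with the
READER CAPACITY `s₀` (`hcap`: a read set contains side slots of at most `s₀` foreign segments — `s₀ = (4(d−1)+2)(L−1)/2` for Bałaban's
averaging, dag-n08-d M3-SPEC §1), and `D ≥ 0` satisfies the multiplier recursion
`x'(1 + D_i)^{r₀} + D_i·(y + D_i)^{L−1}·(1 + (x'/y)(1 + D_i)^{r₀})^{(L−1)ρ₀} ≤ D_{i+1}` (`i < n`, `x' := x / y^{s₀}`), then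
**`Σ_{𝐬 discoverable from Dist 𝐬 n} x^{|𝐬|} ≤ (1 + D_n)^{|β n|}`**, where «discoverable from its own top distorted set» means: at every step each
fired bond is explored (from the top distorted set, through read sets of fired bonds and lines of ghosts) or reads a side slot of an explored
ghost — the class that contains every LIVE pattern of lemma (M) (the complement class has a mute element; separate file), so that with
✓`UV3BranchExpansionDomination.map_actual_le_smul_of_branchExpansion` the constant of hTop is `c = |β n|·D_n`, K- and j-UNIFORM by the fixed
point ✓`UV3BranchExpansionCountingRecursion.D_le_of_multiplier_recursion` (any `θ < 1` with `(y + D)^{L−1}(1 + E/y)^{(L−1)ρ₀} ≤ θ`; numerals —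
e.g. `y = 0.9`, `L = 3`, `s₀ = 10`, `ρ₀ = 11`, `r₀ = 200`, `x = 1.2·10⁻⁵` give `D_* ≤ 2·10⁻⁴` — live in the memo, not in any row).

* §3 (v1.1: primaries `…_of_lt` with level-bounded structural binders; the v1.0 names kept as corollaries) ★ `card_side_sdiff_le_of_capacity` (the non-distorted side slots of ghosts number `≤ s₀·|fired|`), ★★ `pow_card_le_weight` (the capacity
  conversion `x^{|𝐬|} ≤ weight(𝐬)` level by level), ★★★ `sum_pow_card_le_of_discoverable` (conversion + `…Induction.sum_from_le_pow` at `m = n` +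
  grouping by the top distorted set + `Σ_{A ⊆ β n} D_n^{|A|} = (1 + D_n)^{|β n|}`).

HONEST SCOPE.  [folklore] finite combinatorics; the model's instantiation (`β i := PBond P (j+i)`, the (0.4) guard's read sets by
✓`BalabanUVNodesN08GuardReadSet`, `line`∕`centralBond` of lit `AveragingRT`∕`BlockAveragingHaarAC`, the numerals `r₀, ρ₀, s₀`), the lemma
«not discoverable ⇒ mute element» and the measure-side assembly (F-TOP) are NOT here.  Nothing of hTop, the χ (α) record `AlphaInputsT3ACv4RecChi`,
(O‴χₛ), `HistoryTailL`, the rung R3 is proved; the Yang–Mills mass gap is NOT proved.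

References: T. Bałaban, CMP **102** (1985) 255–275 [Balaban1985UV3] ((47), (55) pp.268–270); LEAD note `Cruxes/HistoryTailL/HTopBranchExpansion.md`
§5–§6 (2026-08-30); dag-n08-d `N08-HJ-M3-SPEC-g47.md` §1; OWNER FINDING #51.
-/

set_option autoImplicit false

namespace Summit.QuantumFields.YangMills.Theorems.UV3BranchExpansionCountingAmortized

open Finset Summit.QuantumFields.YangMills.Theorems.UV3BranchExpansionCountingAmortizedLetters
  Summit.QuantumFields.YangMills.Theorems.UV3BranchExpansionCountingAmortizedStep
  Summit.QuantumFields.YangMills.Theorems.UV3BranchExpansionCountingAmortizedInduction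

variable {β : ℕ → Type*} [∀ i, DecidableEq (β i)] {n : ℕ}
variable (R line : (i : ℕ) → β (i + 1) → Finset (β i)) (ctr : (i : ℕ) → β (i + 1) → β i)
variable (Dist : ((i : Fin n) → Finset (β ((i : ℕ) + 1))) → (i : ℕ) → Finset (β i))
variable (X : (m : ℕ) → Finset (β m) → ((i : Fin n) → Finset (β ((i : ℕ) + 1))) → (i : ℕ) → Finset (β i))

/-! ## §3 The capacity conversion and the covering inequality -/

section Cover

variable [∀ i, Fintype (β i)]
variable (N : (i : ℕ) → Finset (β (i + 1)) → Finset (β (i + 1)))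
variable {L r₀ ρ₀ s₀ : ℕ}

/-- ★ **READER CAPACITY.**  If every read set contains side slots of foreign segments numbering at most `s₀`, then the non-distorted side slots of any
set `G` of ghosts (segments that do not fire and whose whole line is distorted or read) number at most `s₀·|s|`, `s` the fired set: each such
slot is read by a fired bond different from its own segment. [folklore] -/
theorem card_side_sdiff_le_of_capacity {i : ℕ}
    (hcap : ∀ c : β (i + 1),
      (((Finset.univ.erase c).biUnion (fun g => (line i g).erase (ctr i g))) ∩ R i c).card ≤ s₀)
    (G s : Finset (β (i + 1))) (Δ : Finset (β i))
    (hG : ∀ g ∈ G, g ∉ s ∧ line i g ⊆ Δ ∪ s.biUnion (R i)) :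
    ((G.biUnion (fun g => (line i g).erase (ctr i g))) \ Δ).card ≤ s₀ * s.card := by
  classical
  have hsub : (G.biUnion (fun g => (line i g).erase (ctr i g))) \ Δ ⊆
      s.biUnion (fun c => ((Finset.univ.erase c).biUnion (fun g => (line i g).erase (ctr i g))) ∩ R i c) := by
    intro b hb
    obtain ⟨hb1, hbΔ⟩ := Finset.mem_sdiff.mp hb
    obtain ⟨g, hg, hbg⟩ := Finset.mem_biUnion.mp hb1
    obtain ⟨hgs, hlg⟩ := hG g hg
    have hbl : b ∈ line i g := Finset.mem_of_mem_erase hbg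
    rcases Finset.mem_union.mp (hlg hbl) with h | h
    · exact absurd h hbΔ
    · obtain ⟨c, hc, hbc⟩ := Finset.mem_biUnion.mp h
      have hgc : g ≠ c := fun h => hgs (h ▸ hc)
      exact Finset.mem_biUnion.mpr ⟨c, hc, Finset.mem_inter.mpr
        ⟨Finset.mem_biUnion.mpr ⟨g, Finset.mem_erase.mpr ⟨hgc, Finset.mem_univ g⟩, hbg⟩, hbc⟩⟩
  calc _ ≤ _ := Finset.card_le_card hsub
    _ ≤ ∑ c ∈ s, (((Finset.univ.erase c).biUnion (fun g => (line i g).erase (ctr i g))) ∩ R i c).card :=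
        Finset.card_biUnion_le
    _ ≤ ∑ _c ∈ s, s₀ := Finset.sum_le_sum (fun c _ => hcap c)
    _ = s₀ * s.card := by rw [Finset.sum_const, smul_eq_mul, mul_comm]

/-- ★★ **THE CAPACITY CONVERSION** (v1.1: capacity asked on the levels `i < n` only — the dischargeable shape, w5-19936 g19) `x^{|𝐬|} ≤ weight(𝐬)` at `x = x'·y^{s₀}`, `0 < y ≤ 1`: for a pattern whose start set at the top level is
contained in its top distorted set, at every level the penalised slots (non-distorted side slots of explored ghosts) number at most `s₀·|p i|`
(capacity), so `x^{|p i|} = x'^{|p i|}·y^{s₀|p i|} ≤ x'^{#explored-fired}·(x'/y)^{#recruited}·y^{#penalised}`. [folklore] -/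
theorem pow_card_le_weight_of_lt
    (hDistS : ∀ p (i : Fin n) (g : β ((i : ℕ) + 1)),
      g ∈ Dist p ((i : ℕ) + 1) ↔ g ∈ p i ∨ line i g ⊆ Dist p i ∪ (p i).biUnion (R i))
    (hXm : ∀ m (A : Finset (β m)) p, X m A p m = A)
    (hXS : ∀ m (A : Finset (β m)) p (i : Fin n), (i : ℕ) < m →
      X m A p i = ((X m A p ((i : ℕ) + 1) \ p i).biUnion (line i) ∪ (p i).biUnion (R i)) ∩ Dist p i)
    (hcap : ∀ i, i < n → ∀ c : β (i + 1),
      (((Finset.univ.erase c).biUnion (fun g => (line i g).erase (ctr i g))) ∩ R i c).card ≤ s₀)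
    {x' y : ℝ} (hx : 0 ≤ x') (hy : 0 < y) (hy1 : y ≤ 1)
    (A : Finset (β n)) (p : (i : Fin n) → Finset (β ((i : ℕ) + 1))) (hA : A ⊆ Dist p n) :
    (x' * y ^ s₀) ^ (∑ i : Fin n, (p i).card) ≤
      ∏ i : Fin n, (if (i : ℕ) < n then
        x' ^ (p i ∩ X n A p ((i : ℕ) + 1)).card * (x' / y) ^ (p i \ X n A p ((i : ℕ) + 1)).card *
          y ^ (((X n A p ((i : ℕ) + 1) \ p i).biUnion (fun g => (line i g).erase (ctr i g))) \ Dist p i).card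
        else 1) := by
  classical
  have hy0 : 0 ≤ y := hy.le
  -- the explored sets lie in the distorted sets
  have hXsub : ∀ k, k ≤ n → X n A p k ⊆ Dist p k := by
    intro k hk
    rcases Nat.lt_or_eq_of_le hk with h | h
    · have := hXS n A p ⟨k, h⟩ h
      simp only [Fin.val_mk] at this
      rw [this]; exact Finset.inter_subset_right
    · subst h; rw [hXm]; exact hA
  rw [← Finset.prod_pow_eq_pow_sum]
  refine Finset.prod_le_prod (fun i _ => by positivity) (fun i _ => ?_)
  rw [if_pos i.isLt]
  -- capacity at level `i`
  have hpen : ((((X n A p ((i : ℕ) + 1)) \ p i).biUnion (fun g => (line i g).erase (ctr i g))) \ Dist p i).card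
      ≤ s₀ * (p i).card :=
    card_side_sdiff_le_of_capacity R line ctr (hcap i i.isLt) _ _ _ (fun g hg => by
      obtain ⟨hgX, hgp⟩ := Finset.mem_sdiff.mp hg
      refine ⟨hgp, ?_⟩
      have hgD := hXsub ((i : ℕ) + 1) (Nat.succ_le_of_lt i.isLt) hgX
      rcases (hDistS p i g).mp hgD with h | h
      · exact absurd h hgp
      · exact h)
  have hab : (p i ∩ X n A p ((i : ℕ) + 1)).card + (p i \ X n A p ((i : ℕ) + 1)).card = (p i).card :=
    Finset.card_inter_add_card_sdiff _ _
  set a := (p i ∩ X n A p ((i : ℕ) + 1)).card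
  set b := (p i \ X n A p ((i : ℕ) + 1)).card
  set c := ((((X n A p ((i : ℕ) + 1)) \ p i).biUnion (fun g => (line i g).erase (ctr i g))) \ Dist p i).card
  have hyc : y ^ (s₀ * (p i).card) ≤ y ^ c := pow_le_pow_of_le_one hy0 hy1 hpen
  have hyb : (1 : ℝ) ≤ (1 / y) ^ b := one_le_pow₀ (one_le_one_div hy hy1)
  calc (x' * y ^ s₀) ^ (p i).card = x' ^ (p i).card * y ^ (s₀ * (p i).card) := by rw [mul_pow, ← pow_mul]
    _ ≤ x' ^ (p i).card * (y ^ c * (1 / y) ^ b) :=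
        mul_le_mul_of_nonneg_left (hyc.trans (le_mul_of_one_le_right (pow_nonneg hy0 _) hyb)) (pow_nonneg hx _)
    _ = x' ^ a * (x' / y) ^ b * y ^ c := by rw [← hab, pow_add, div_eq_mul_one_div x' y, mul_pow]; ring

/-- v1.0 statement of `pow_card_le_weight_of_lt` (capacity for every `i : ℕ`), kept as its corollary. [folklore] -/
theorem pow_card_le_weight
    (hDistS : ∀ p (i : Fin n) (g : β ((i : ℕ) + 1)),
      g ∈ Dist p ((i : ℕ) + 1) ↔ g ∈ p i ∨ line i g ⊆ Dist p i ∪ (p i).biUnion (R i))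
    (hXm : ∀ m (A : Finset (β m)) p, X m A p m = A)
    (hXS : ∀ m (A : Finset (β m)) p (i : Fin n), (i : ℕ) < m →
      X m A p i = ((X m A p ((i : ℕ) + 1) \ p i).biUnion (line i) ∪ (p i).biUnion (R i)) ∩ Dist p i)
    (hcap : ∀ i (c : β (i + 1)),
      (((Finset.univ.erase c).biUnion (fun g => (line i g).erase (ctr i g))) ∩ R i c).card ≤ s₀)
    {x' y : ℝ} (hx : 0 ≤ x') (hy : 0 < y) (hy1 : y ≤ 1)
    (A : Finset (β n)) (p : (i : Fin n) → Finset (β ((i : ℕ) + 1))) (hA : A ⊆ Dist p n) :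
    (x' * y ^ s₀) ^ (∑ i : Fin n, (p i).card) ≤
      ∏ i : Fin n, (if (i : ℕ) < n then
        x' ^ (p i ∩ X n A p ((i : ℕ) + 1)).card * (x' / y) ^ (p i \ X n A p ((i : ℕ) + 1)).card *
          y ^ (((X n A p ((i : ℕ) + 1) \ p i).biUnion (fun g => (line i g).erase (ctr i g))) \ Dist p i).card
        else 1) :=
  pow_card_le_weight_of_lt R line ctr Dist X hDistS hXm hXS (fun i _ => hcap i) hx hy hy1 A p hA

/-- ★★★ **THE AMORTIZED COVERING INEQUALITY** (v1.1: the seven structural binders are asked on the levels `i < n` only — the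
dischargeable shape on a finite tower; beyond the standing range no `line i` satisfies `hline ∧ hdisj`, w5-19936 g19 2026-08-30).  Let `0 ≤ x`, `0 < y ≤ 1`, and let the per-level blocking data satisfy the six geometric
hypotheses plus the reader CAPACITY `s₀`; put `x' := x / y^{s₀}` and let `D` satisfy `0 ≤ D` and the multiplier recursion
`x'(1 + D_i)^{r₀} + D_i·(y + D_i)^{L−1}·(1 + (x'/y)(1 + D_i)^{r₀})^{(L−1)ρ₀} ≤ D_{i+1}` (`i < n`).  Then the sum of `x^{|𝐬|}` over all patterns
`𝐬` that are DISCOVERABLE FROM THEIR OWN TOP DISTORTED SET — every fired bond is explored from `Dist 𝐬 n` or reads a side slot of an explored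
ghost — is at most `(1 + D_n)^{|β n|}`.  With (F-M2) «not discoverable ⇒ a mute element ⇒ the branch pair cancels» and (F-2)
`map_actual_le_smul_of_branchExpansion`, this is the counting half of hTop with the K-uniform constant `c = |β n|·D_n` (the fixed point of the
recursion is `UV3BranchExpansionCountingRecursion.D_le_of_multiplier_recursion`, K- and j-free).  It REPLACES §5 (C)'s tree count of the LEAD
note (whose injection fails at shared readers). [folklore] -/
theorem sum_pow_card_le_of_discoverable_of_lt
    (hctr : ∀ i, i < n → ∀ g, ctr i g ∈ line i g) (hline : ∀ i, i < n → ∀ g, (line i g).card = L)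
    (hdisj : ∀ i, i < n → ∀ g g', g ≠ g' → Disjoint (line i g) (line i g'))
    (hpriv : ∀ i, i < n → ∀ g c, ctr i g ∈ R i c → c = g) (hR : ∀ i, i < n → ∀ c, (R i c).card ≤ r₀)
    (hρ : ∀ i, i < n → ∀ b : β i, (Finset.univ.filter (fun c => b ∈ R i c)).card ≤ ρ₀)
    (hcap : ∀ i, i < n → ∀ c : β (i + 1),
      (((Finset.univ.erase c).biUnion (fun g => (line i g).erase (ctr i g))) ∩ R i c).card ≤ s₀)
    (hDist0 : ∀ p, Dist p 0 = ∅)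
    (hDistS : ∀ p (i : Fin n) (g : β ((i : ℕ) + 1)),
      g ∈ Dist p ((i : ℕ) + 1) ↔ g ∈ p i ∨ line i g ⊆ Dist p i ∪ (p i).biUnion (R i))
    (hXm : ∀ m (A : Finset (β m)) p, X m A p m = A)
    (hXS : ∀ m (A : Finset (β m)) p (i : Fin n), (i : ℕ) < m →
      X m A p i = ((X m A p ((i : ℕ) + 1) \ p i).biUnion (line i) ∪ (p i).biUnion (R i)) ∩ Dist p i)
    (hN : ∀ i G c, c ∈ N i G ↔ ∃ g ∈ G, ∃ b ∈ (line i g).erase (ctr i g), b ∈ R i c)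
    {x y : ℝ} (hx : 0 ≤ x) (hy : 0 < y) (hy1 : y ≤ 1) {D : ℕ → ℝ} (hD : ∀ i, 0 ≤ D i)
    (hstep : ∀ i, i < n →
      x / y ^ s₀ * (1 + D i) ^ r₀ +
        D i * (y + D i) ^ (L - 1) * (1 + x / y ^ s₀ / y * (1 + D i) ^ r₀) ^ ((L - 1) * ρ₀) ≤ D (i + 1)) :
    ∑ p ∈ (Finset.univ : Finset ((i : Fin n) → Finset (β ((i : ℕ) + 1)))).filter
        (fun p => ∀ i : Fin n, p i ⊆ X n (Dist p n) p ((i : ℕ) + 1) ∪ N i (X n (Dist p n) p ((i : ℕ) + 1) \ p i)),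
      x ^ (∑ i : Fin n, (p i).card) ≤ (1 + D n) ^ Fintype.card (β n) := by
  classical
  have hys : 0 < y ^ s₀ := pow_pos hy _
  have hx' : 0 ≤ x / y ^ s₀ := div_nonneg hx hys.le
  have hxx : x = x / y ^ s₀ * y ^ s₀ := (div_mul_cancel₀ x hys.ne').symm
  have main := sum_from_le_pow_of_lt R line ctr Dist X N hctr hline hdisj hpriv hR hρ hDist0 hDistS hXm hXS hN hx' hy hD
    hstep n le_rfl
  -- abbreviation of the weight at the top level
  let Wt : Finset (β n) → ((i : Fin n) → Finset (β ((i : ℕ) + 1))) → ℝ := fun A p =>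
    ∏ i : Fin n, (if (i : ℕ) < n then
      (x / y ^ s₀) ^ (p i ∩ X n A p ((i : ℕ) + 1)).card * (x / y ^ s₀ / y) ^ (p i \ X n A p ((i : ℕ) + 1)).card *
        y ^ (((X n A p ((i : ℕ) + 1) \ p i).biUnion (fun g => (line i g).erase (ctr i g))) \ Dist p i).card
      else 1)
  have hWt0 : ∀ A p, 0 ≤ Wt A p := fun A p => Finset.prod_nonneg (fun i _ => by
    by_cases h : (i : ℕ) < n
    · rw [if_pos h]; positivity
    · rw [if_neg h]; exact zero_le_one)
  calc ∑ p ∈ (Finset.univ : Finset ((i : Fin n) → Finset (β ((i : ℕ) + 1)))).filter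
          (fun p => ∀ i : Fin n, p i ⊆ X n (Dist p n) p ((i : ℕ) + 1) ∪ N i (X n (Dist p n) p ((i : ℕ) + 1) \ p i)),
          x ^ (∑ i : Fin n, (p i).card)
      ≤ ∑ p ∈ (Finset.univ : Finset ((i : Fin n) → Finset (β ((i : ℕ) + 1)))).filter
          (fun p => ∀ i : Fin n, p i ⊆ X n (Dist p n) p ((i : ℕ) + 1) ∪ N i (X n (Dist p n) p ((i : ℕ) + 1) \ p i)),
          Wt (Dist p n) p := by
        refine Finset.sum_le_sum (fun p _ => ?_)
        rw [hxx]
        exact pow_card_le_weight_of_lt R line ctr Dist X hDistS hXm hXS hcap hx' hy hy1 (Dist p n) p subset_rfl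
    _ = ∑ A : Finset (β n), ∑ p ∈ ((Finset.univ : Finset ((i : Fin n) → Finset (β ((i : ℕ) + 1)))).filter
          (fun p => ∀ i : Fin n, p i ⊆ X n (Dist p n) p ((i : ℕ) + 1) ∪
            N i (X n (Dist p n) p ((i : ℕ) + 1) \ p i))).filter (fun p => Dist p n = A), Wt (Dist p n) p :=
        (Finset.sum_fiberwise_of_maps_to (fun p _ => Finset.mem_univ (Dist p n)) _).symm
    _ ≤ ∑ A : Finset (β n), ∑ p : ((i : Fin n) → Finset (β ((i : ℕ) + 1))),
          (if (∀ i : Fin n, n ≤ (i : ℕ) → p i = ∅) ∧ A ⊆ Dist p n ∧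
              (∀ i : Fin n, (i : ℕ) < n → p i ⊆ X n A p ((i : ℕ) + 1) ∪ N i (X n A p ((i : ℕ) + 1) \ p i)) then
            Wt A p else 0) := by
        refine Finset.sum_le_sum (fun A _ => ?_)
        rw [← Finset.sum_filter]
        have hcongr : ∑ p ∈ ((Finset.univ : Finset ((i : Fin n) → Finset (β ((i : ℕ) + 1)))).filter
            (fun p => ∀ i : Fin n, p i ⊆ X n (Dist p n) p ((i : ℕ) + 1) ∪
              N i (X n (Dist p n) p ((i : ℕ) + 1) \ p i))).filter (fun p => Dist p n = A), Wt (Dist p n) p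
            = ∑ p ∈ ((Finset.univ : Finset ((i : Fin n) → Finset (β ((i : ℕ) + 1)))).filter
            (fun p => ∀ i : Fin n, p i ⊆ X n (Dist p n) p ((i : ℕ) + 1) ∪
              N i (X n (Dist p n) p ((i : ℕ) + 1) \ p i))).filter (fun p => Dist p n = A), Wt A p :=
          Finset.sum_congr rfl (fun p hp => by rw [(Finset.mem_filter.mp hp).2])
        rw [hcongr]
        refine Finset.sum_le_sum_of_subset_of_nonneg ?_ (fun p _ _ => hWt0 A p)
        intro p hp
        obtain ⟨hp1, hp2⟩ := Finset.mem_filter.mp hp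
        have hdsc := (Finset.mem_filter.mp hp1).2
        refine Finset.mem_filter.mpr ⟨Finset.mem_univ _, fun i hi => absurd i.isLt (not_lt.mpr hi), hp2 ▸ subset_rfl, ?_⟩
        intro i _
        rw [← hp2]; exact hdsc i
    _ ≤ ∑ A : Finset (β n), D n ^ A.card := Finset.sum_le_sum (fun A _ => main A)
    _ = (1 + D n) ^ Fintype.card (β n) := by
        rw [← Finset.powerset_univ, sum_powerset_pow_card, Finset.card_univ]

/-- v1.0 statement of `sum_pow_card_le_of_discoverable_of_lt` (structural binders for every `i : ℕ`), kept as its corollary. [folklore] -/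
theorem sum_pow_card_le_of_discoverable
    (hctr : ∀ i g, ctr i g ∈ line i g) (hline : ∀ i g, (line i g).card = L)
    (hdisj : ∀ i g g', g ≠ g' → Disjoint (line i g) (line i g'))
    (hpriv : ∀ i g c, ctr i g ∈ R i c → c = g) (hR : ∀ i c, (R i c).card ≤ r₀)
    (hρ : ∀ i (b : β i), (Finset.univ.filter (fun c => b ∈ R i c)).card ≤ ρ₀)
    (hcap : ∀ i (c : β (i + 1)),
      (((Finset.univ.erase c).biUnion (fun g => (line i g).erase (ctr i g))) ∩ R i c).card ≤ s₀)
    (hDist0 : ∀ p, Dist p 0 = ∅)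
    (hDistS : ∀ p (i : Fin n) (g : β ((i : ℕ) + 1)),
      g ∈ Dist p ((i : ℕ) + 1) ↔ g ∈ p i ∨ line i g ⊆ Dist p i ∪ (p i).biUnion (R i))
    (hXm : ∀ m (A : Finset (β m)) p, X m A p m = A)
    (hXS : ∀ m (A : Finset (β m)) p (i : Fin n), (i : ℕ) < m →
      X m A p i = ((X m A p ((i : ℕ) + 1) \ p i).biUnion (line i) ∪ (p i).biUnion (R i)) ∩ Dist p i)
    (hN : ∀ i G c, c ∈ N i G ↔ ∃ g ∈ G, ∃ b ∈ (line i g).erase (ctr i g), b ∈ R i c)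
    {x y : ℝ} (hx : 0 ≤ x) (hy : 0 < y) (hy1 : y ≤ 1) {D : ℕ → ℝ} (hD : ∀ i, 0 ≤ D i)
    (hstep : ∀ i, i < n →
      x / y ^ s₀ * (1 + D i) ^ r₀ +
        D i * (y + D i) ^ (L - 1) * (1 + x / y ^ s₀ / y * (1 + D i) ^ r₀) ^ ((L - 1) * ρ₀) ≤ D (i + 1)) :
    ∑ p ∈ (Finset.univ : Finset ((i : Fin n) → Finset (β ((i : ℕ) + 1)))).filter
        (fun p => ∀ i : Fin n, p i ⊆ X n (Dist p n) p ((i : ℕ) + 1) ∪ N i (X n (Dist p n) p ((i : ℕ) + 1) \ p i)),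
      x ^ (∑ i : Fin n, (p i).card) ≤ (1 + D n) ^ Fintype.card (β n) :=
  sum_pow_card_le_of_discoverable_of_lt R line ctr Dist X N (fun i _ => hctr i) (fun i _ => hline i) (fun i _ => hdisj i)
    (fun i _ => hpriv i) (fun i _ => hR i) (fun i _ => hρ i) (fun i _ => hcap i) hDist0 hDistS hXm hXS hN hx hy hy1 hD hstep

end Cover

end Summit.QuantumFields.YangMills.Theorems.UV3BranchExpansionCountingAmortized
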